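import Mathlib
import Literature.Probability.Percolation.QuadLowestCrossingProofs
import Literature.Probability.Percolation.QuadCrossingQuadTopology
import Literature.Probability.Percolation.QuadCrossingRawClosed
import Literature.Probability.Percolation.IsoradialProofs
import Literature.Topology.PlaneTopology.PlusCrossing
import HarnessLib

/-!
# A mesh-independent tube of boxes whose crossings force the crossing of a quad

Helper file for the stub `stub_jointCrossing_nondegenerate` (D1) of the line `Sketch` (crux
`stmt-CriticalPhenomena-10269`, `…Theses.CardySelfRefinement.GradientComparability`): the
deterministic (topological) half of the Russo–Seymour–Welsh argument showing that the probability
that all quads of a finite family are crossed by critical bond percolation on `ℤ²` at mesh `η`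
stays in `[c₀, 1 - c₀]`; the probabilistic half is `…StubJointCrossingNondegenerate.lean`.

## Mathematics

Straighten the quad `Q` by a homeomorphism `H` of the plane (`Quad.exists_straighten`:
`[Q] = H([-1,1]²)`, `∂₀Q`/`∂₂Q` the images of the vertical edges).  Along the arc `H([-2, 2])`
choose ONCE AND FOR ALL points `P₀, …, P_N` at consecutive distances `≤ s`, `s` so small (room of
the chart, `exists_chart_room`) that points within `10 s` of the arc pull back into the band
`|im| ≤ 1/2`.  A compact connected plane set `C ⊆ GOOD` within `10 s` of the points and reaching
the `10 s`-neighbourhoods of `P₀` and `P_N` pulls back to a continuum crossing the strip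
`-1 ≤ re ≤ 1` inside the band (`exists_subcontinuum_between_lines`), whose `H`-image is a crossing
of `Q` inside `GOOD` (`stub_jointCrossing_tube`, registered sub-goal of the stub).  Such a `C` is
glued (plus position, `inter_nonempty_of_plus`; `plus_meet`, `chain`) from open long-way
crossings of `2(N+1)` rectangles of aspect ratio `8` and
size `≈ s` around the `P_j`, read at mesh `η` from the tree's embedded events `embRectCrossing` /
`embTBCrossing` as drawn traces of open lattice walks, possibly shifted by `t` with
`|re t|, |im t| ≤ 2η` so as to serve the dual lattice too (`boxH_continuum`, `boxV_continuum`).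
-/

noncomputable section

namespace Summit.CriticalPhenomena.CardyFormulaZ2.Theorems.CardySelfRefinement

open scoped Topology
open Filter Set MeasureTheory Metric
open Literature.Probability.LatticeModels Literature.Probability.Percolation
open Literature.Probability.Percolation.QuadCrossing
open Literature.Topology.PlaneTopology

/-! ## The drawn trace of an open lattice crossing -/

/-- Affine images of segment points are segment points. -/
theorem mul_add_mem_segment {a b q : ℂ} (hq : q ∈ segment ℝ a b) (δ : ℝ) (t : ℂ) :
    (δ : ℂ) * q + t ∈ segment ℝ ((δ : ℂ) * a + t) ((δ : ℂ) * b + t) := by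
  obtain ⟨θ₁, θ₂, h₁, h₂, hsum, rfl⟩ := hq
  refine ⟨θ₁, θ₂, h₁, h₂, hsum, ?_⟩
  have hsum' : (θ₁ : ℂ) + θ₂ = 1 := by exact_mod_cast hsum
  simp only [Complex.real_smul]
  linear_combination t * hsum'

/-- **The drawn trace of an open crossing.**  On a lattice configuration `ω ⊆ E(ℤ²)`, an open
crossing from `A` to `B` inside `S` (`A`, `B` disjoint) is drawn at mesh `δ` and shifted by `t`
as a compact connected plane set inside any convex set containing the (shifted) sites of `S`; its
points shifted back by `t` are drawn open edges, and it contains the positions of a site of `A`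
and of a site of `B`. -/
theorem exists_continuum_of_openCrossing {ω : BondConfig (Site 2)}
    (hω : ω ⊆ (zdGraph 2).edgeSet) {S A B : Set (Site 2)} (h : ω ∈ openCrossing S A B)
    (hAB : ∀ x ∈ A, ∀ y ∈ B, x ≠ y) (δ : ℝ) (t : ℂ) {R : Set ℂ} (hR : Convex ℝ R)
    (hSR : ∀ v ∈ S, (δ : ℂ) * Site.toComplex v + t ∈ R) :
    ∃ C : Set ℂ, IsCompact C ∧ IsPreconnected C ∧ C ⊆ R ∧
      (∀ z ∈ C, z - t ∈ openEdgeUnion δ ω) ∧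
      (∃ a ∈ A, (δ : ℂ) * Site.toComplex a + t ∈ C) ∧
      ∃ b ∈ B, (δ : ℂ) * Site.toComplex b + t ∈ C := by
  obtain ⟨x, hx, y, hy, hconn⟩ := mem_openCrossing_iff.1 h
  obtain ⟨p, hpS, hpω⟩ := exists_walk_of_mem_openConnIn hω hconn
  have hp : ¬ p.Nil := SimpleGraph.Walk.not_nil_of_ne (hAB x hx y hy)
  set f : ℂ → ℂ := fun q => (δ : ℂ) * q + t with hf
  have hfc : Continuous f := by fun_prop
  refine ⟨f '' walkTrace p, (SSContinuity.isCompact_walkTrace p).image hfc,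
    (isPreconnected_walkTrace p).image f hfc.continuousOn, ?_, ?_,
    ⟨x, hx, ⟨_, toComplex_start_mem_walkTrace hp, rfl⟩⟩,
    ⟨y, hy, ⟨_, toComplex_end_mem_walkTrace hp, rfl⟩⟩⟩
  · rintro _ ⟨q, hq, rfl⟩
    obtain ⟨e, he, hqe⟩ := mem_walkTrace_iff.1 hq
    induction e using Sym2.ind with
    | h u v =>
      rw [edgeTrace_mk] at hqe
      exact hR.segment_subset (hSR u (hpS u (p.fst_mem_support_of_mem_edges he)))
        (hSR v (hpS v (p.snd_mem_support_of_mem_edges he))) (mul_add_mem_segment hqe δ t)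
  · rintro _ ⟨q, hq, rfl⟩
    obtain ⟨e, he, hqe⟩ := mem_walkTrace_iff.1 hq
    induction e using Sym2.ind with
    | h u v =>
      rw [edgeTrace_mk] at hqe
      have hadj : (zdGraph 2).Adj u v := (SimpleGraph.mem_edgeSet _).1 (p.edges_subset_edgeSet he)
      refine mem_openEdgeUnion_iff.2 ⟨u, v, hadj, hpω _ he, ?_⟩
      have h' := mul_add_mem_segment hqe δ 0
      simp only [add_zero] at h'
      simpa [hf, meshPoint] using h'

/-- Real part of a drawn (shifted) site at mesh `η√2`. -/
theorem re_draw (η : ℝ) (v : Site 2) (t : ℂ) :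
    (((η * Real.sqrt 2 : ℝ) : ℂ) * Site.toComplex v + t).re =
      η * (Real.sqrt 2 * (v 0 : ℝ)) + t.re := by
  simp; ring

/-- Imaginary part of a drawn (shifted) site at mesh `η√2`. -/
theorem im_draw (η : ℝ) (v : Site 2) (t : ℂ) :
    (((η * Real.sqrt 2 : ℝ) : ℂ) * Site.toComplex v + t).im =
      η * (Real.sqrt 2 * (v 1 : ℝ)) + t.im := by
  simp; ring

/-- **Horizontal box crossing ⇒ horizontal continuum.**  An open long-way crossing of the
translated `8n × n` rectangle placed (in mesh-`η` plane coordinates) with left end at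
`re = p.re - 3s - 2η` and bottom at `im = p.im - s + 2η`, drawn at mesh `η√2` and shifted by `t`
(`|re t|, |im t| ≤ 2η`), is a continuum in the band `[p.im - s, p.im + s]`, within the box
`[p.re - 4s, p.re + 6s]`, reaching `re ≤ p.re - 3s` and `re ≥ p.re + 3s`
(`6η ≤ s`, `s - η < ηn ≤ s`). -/
theorem boxH_continuum {η s : ℝ} (hη : 0 < η) (hηs : 6 * η ≤ s) {n : ℕ} (hn : s - η < η * n)
    (hn' : η * n ≤ s) (p t : ℂ) (htr : |t.re| ≤ 2 * η) (hti : |t.im| ≤ 2 * η) {w : ℂ}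
    (hw₁ : η * w.re = p.re - 3 * s - 2 * η) (hw₂ : η * w.im = p.im - s + 2 * η)
    {ω : BondConfig (Site 2)} (hω : ω ⊆ (zdGraph 2).edgeSet)
    (h : ω ∈ embRectCrossing (fun v => squareLatticeEmbedding.z v - w) (8 * n) n) :
    ∃ C : Set ℂ, IsCompact C ∧ IsPreconnected C ∧
      C ⊆ Icc (p.re - 4 * s) (p.re + 6 * s) ×ℂ Icc (p.im - s) (p.im + s) ∧
      (∀ z ∈ C, z - t ∈ openEdgeUnion (η * Real.sqrt 2) ω) ∧
      (∃ z ∈ C, z.re ≤ p.re - 3 * s) ∧ ∃ z ∈ C, p.re + 3 * s ≤ z.re := by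
  obtain ⟨C, hCc, hCp, hCR, hCO, ⟨a, ha, haC⟩, ⟨b, hb, hbC⟩⟩ :=
    exists_continuum_of_openCrossing hω h (fun x hx y hy hxy => by
      subst hxy
      have h1 : (8 * n : ℝ) ≤ 0 := le_trans hy hx
      have h2 : (0 : ℝ) < n := pos_of_mul_pos_right (by linarith) hη.le
      linarith) (η * Real.sqrt 2) t
      (convex_Icc_reProdIm_Icc (p.re - 4 * s) (p.re + 6 * s) (p.im - s) (p.im + s))
      (fun v hv => by
      obtain ⟨⟨h1, h2⟩, ⟨h3, h4⟩⟩ := hv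
      simp only [squareLatticeEmbedding_z_sub_re, squareLatticeEmbedding_z_sub_im] at h1 h2 h3 h4
      rw [Complex.mem_reProdIm, re_draw, im_draw]
      refine ⟨⟨?_, ?_⟩, ⟨?_, ?_⟩⟩ <;>
        nlinarith [mul_le_mul_of_nonneg_left h1 hη.le, mul_le_mul_of_nonneg_left h2 hη.le,
          mul_le_mul_of_nonneg_left h3 hη.le, mul_le_mul_of_nonneg_left h4 hη.le,
          (abs_le.1 htr).1, (abs_le.1 htr).2, (abs_le.1 hti).1, (abs_le.1 hti).2])
  refine ⟨C, hCc, hCp, hCR, hCO, ⟨_, haC, ?_⟩, ⟨_, hbC, ?_⟩⟩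
  · have ha' : Real.sqrt 2 * (a 0 : ℝ) - w.re ≤ 0 := by
      have := ha; simp only [mem_setOf_eq, squareLatticeEmbedding_z_sub_re] at this; exact this
    rw [re_draw]
    nlinarith [mul_le_mul_of_nonneg_left ha' hη.le, (abs_le.1 htr).1, (abs_le.1 htr).2]
  · have hb' : (8 * n : ℝ) ≤ Real.sqrt 2 * (b 0 : ℝ) - w.re := by
      have := hb; simp only [mem_setOf_eq, squareLatticeEmbedding_z_sub_re] at this; exact this
    rw [re_draw]
    nlinarith [mul_le_mul_of_nonneg_left hb' hη.le, (abs_le.1 htr).1, (abs_le.1 htr).2]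

/-- **Vertical box crossing ⇒ vertical continuum** (the transposed companion of
`boxH_continuum`, for the `n × 8n` rectangle with bottom end at `im = p.im - 3s - 2η` and left
side at `re = p.re - s + 2η`). -/
theorem boxV_continuum {η s : ℝ} (hη : 0 < η) (hηs : 6 * η ≤ s) {n : ℕ} (hn : s - η < η * n)
    (hn' : η * n ≤ s) (p t : ℂ) (htr : |t.re| ≤ 2 * η) (hti : |t.im| ≤ 2 * η) {w : ℂ}
    (hw₁ : η * w.re = p.re - s + 2 * η) (hw₂ : η * w.im = p.im - 3 * s - 2 * η)
    {ω : BondConfig (Site 2)} (hω : ω ⊆ (zdGraph 2).edgeSet)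
    (h : ω ∈ embTBCrossing (fun v => squareLatticeEmbedding.z v - w) n (8 * n)) :
    ∃ C : Set ℂ, IsCompact C ∧ IsPreconnected C ∧
      C ⊆ Icc (p.re - s) (p.re + s) ×ℂ Icc (p.im - 4 * s) (p.im + 6 * s) ∧
      (∀ z ∈ C, z - t ∈ openEdgeUnion (η * Real.sqrt 2) ω) ∧
      (∃ z ∈ C, z.im ≤ p.im - 3 * s) ∧ ∃ z ∈ C, p.im + 3 * s ≤ z.im := by
  obtain ⟨C, hCc, hCp, hCR, hCO, ⟨a, ha, haC⟩, ⟨b, hb, hbC⟩⟩ :=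
    exists_continuum_of_openCrossing hω h (fun x hx y hy hxy => by
      subst hxy
      have h1 : (8 * n : ℝ) ≤ 0 := le_trans hy hx
      have h2 : (0 : ℝ) < n := pos_of_mul_pos_right (by linarith) hη.le
      linarith) (η * Real.sqrt 2) t
      (convex_Icc_reProdIm_Icc (p.re - s) (p.re + s) (p.im - 4 * s) (p.im + 6 * s))
      (fun v hv => by
      obtain ⟨⟨h1, h2⟩, ⟨h3, h4⟩⟩ := hv
      simp only [squareLatticeEmbedding_z_sub_re, squareLatticeEmbedding_z_sub_im] at h1 h2 h3 h4
      rw [Complex.mem_reProdIm, re_draw, im_draw]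
      refine ⟨⟨?_, ?_⟩, ⟨?_, ?_⟩⟩ <;>
        nlinarith [mul_le_mul_of_nonneg_left h1 hη.le, mul_le_mul_of_nonneg_left h2 hη.le,
          mul_le_mul_of_nonneg_left h3 hη.le, mul_le_mul_of_nonneg_left h4 hη.le,
          (abs_le.1 htr).1, (abs_le.1 htr).2, (abs_le.1 hti).1, (abs_le.1 hti).2])
  refine ⟨C, hCc, hCp, hCR, hCO, ⟨_, haC, ?_⟩, ⟨_, hbC, ?_⟩⟩
  · have ha' : Real.sqrt 2 * (a 1 : ℝ) - w.im ≤ 0 := by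
      have := ha; simp only [mem_setOf_eq, squareLatticeEmbedding_z_sub_im] at this; exact this
    rw [im_draw]
    nlinarith [mul_le_mul_of_nonneg_left ha' hη.le, (abs_le.1 hti).1, (abs_le.1 hti).2]
  · have hb' : (8 * n : ℝ) ≤ Real.sqrt 2 * (b 1 : ℝ) - w.im := by
      have := hb; simp only [mem_setOf_eq, squareLatticeEmbedding_z_sub_im] at this; exact this
    rw [im_draw]
    nlinarith [mul_le_mul_of_nonneg_left hb' hη.le, (abs_le.1 hti).1, (abs_le.1 hti).2]

/-! ## Gluing the crossings: plus position and the chain -/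

/-- **Plus position.**  A horizontal continuum around `P` (band `[P.im - s, P.im + s]`, reaching
`re ≤ P.re - 3s` and `re ≥ P.re + 3s`) meets a vertical continuum around a point `P'` with
`dist P P' ≤ s` (strip `[P'.re - s, P'.re + s]`, reaching `im ≤ P'.im - 3s` and
`im ≥ P'.im + 3s`). -/
theorem plus_meet {P P' : ℂ} {s : ℝ} (hd : dist P P' ≤ s) {Hc Vc : Set ℂ}
    (hH : IsCompact Hc) (hHc : IsPreconnected Hc)
    (hHR : Hc ⊆ Icc (P.re - 4 * s) (P.re + 6 * s) ×ℂ Icc (P.im - s) (P.im + s))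
    (hHa : ∃ z ∈ Hc, z.re ≤ P.re - 3 * s) (hHb : ∃ z ∈ Hc, P.re + 3 * s ≤ z.re)
    (hV : IsCompact Vc) (hVc : IsPreconnected Vc)
    (hVR : Vc ⊆ Icc (P'.re - s) (P'.re + s) ×ℂ Icc (P'.im - 4 * s) (P'.im + 6 * s))
    (hVa : ∃ z ∈ Vc, z.im ≤ P'.im - 3 * s) (hVb : ∃ z ∈ Vc, P'.im + 3 * s ≤ z.im) :
    (Vc ∩ Hc).Nonempty := by
  have hs : 0 ≤ s := dist_nonneg.trans hd
  have hre : |P.re - P'.re| ≤ s := by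
    have := Complex.abs_re_le_norm (P - P')
    rw [Complex.sub_re] at this
    exact this.trans (by rwa [← dist_eq_norm])
  have him : |P.im - P'.im| ≤ s := by
    have := Complex.abs_im_le_norm (P - P')
    rw [Complex.sub_im] at this
    exact this.trans (by rwa [← dist_eq_norm])
  rw [abs_le] at hre him
  obtain ⟨za, hza, hzare⟩ := hHa
  obtain ⟨zb, hzb, hzbre⟩ := hHb
  obtain ⟨zc, hzc, hzcim⟩ := hVa
  obtain ⟨zd, hzd, hzdim⟩ := hVb
  refine inter_nonempty_of_plus (a := P'.re - s) (b := P'.re + s) (c := P.im - s) (d := P.im + s)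
    (by linarith) (by linarith) hV hVc (fun z hz => (Complex.mem_reProdIm.1 (hVR hz)).1)
    ⟨zc, hzc, by linarith⟩ ⟨zd, hzd, by linarith⟩ hH hHc
    (fun z hz => (Complex.mem_reProdIm.1 (hHR hz)).2) ⟨za, hza, by linarith⟩ ⟨zb, hzb, by linarith⟩

/-- Points of the two boxes around `P` are within `10 s` of `P`. -/
theorem dist_le_of_mem_boxes {P z : ℂ} {s : ℝ}
    (hz : z ∈ Icc (P.re - 4 * s) (P.re + 6 * s) ×ℂ Icc (P.im - s) (P.im + s) ∨
      z ∈ Icc (P.re - s) (P.re + s) ×ℂ Icc (P.im - 4 * s) (P.im + 6 * s)) :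
    dist z P ≤ 10 * s := by
  rw [dist_eq_norm]
  refine (Complex.norm_le_abs_re_add_abs_im _).trans ?_
  rw [Complex.sub_re, Complex.sub_im]
  rcases hz with hz | hz <;>
  · obtain ⟨⟨h1, h2⟩, ⟨h3, h4⟩⟩ := Complex.mem_reProdIm.1 hz
    cases abs_cases (z.re - P.re) <;> cases abs_cases (z.im - P.im) <;> linarith

/-- **The chain.**  Horizontal and vertical continua around points `P₀, …, P_N` at consecutive
distances `≤ s`, all inside `GOOD`, glue into one continuum inside `GOOD`, within `10 s` of the
points, containing the vertical continuum at `P₀` and the horizontal one at `P_N`. -/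
theorem chain (P : ℕ → ℂ) {s : ℝ} (GOOD : Set ℂ) (Hc Vc : ℕ → Set ℂ) (N : ℕ)
    (hP : ∀ j < N, dist (P j) (P (j + 1)) ≤ s)
    (hH : ∀ j ≤ N, IsCompact (Hc j) ∧ IsPreconnected (Hc j) ∧ Hc j ⊆ GOOD ∧
      Hc j ⊆ Icc ((P j).re - 4 * s) ((P j).re + 6 * s) ×ℂ Icc ((P j).im - s) ((P j).im + s) ∧
      (∃ z ∈ Hc j, z.re ≤ (P j).re - 3 * s) ∧ ∃ z ∈ Hc j, (P j).re + 3 * s ≤ z.re)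
    (hV : ∀ j ≤ N, IsCompact (Vc j) ∧ IsPreconnected (Vc j) ∧ Vc j ⊆ GOOD ∧
      Vc j ⊆ Icc ((P j).re - s) ((P j).re + s) ×ℂ Icc ((P j).im - 4 * s) ((P j).im + 6 * s) ∧
      (∃ z ∈ Vc j, z.im ≤ (P j).im - 3 * s) ∧ ∃ z ∈ Vc j, (P j).im + 3 * s ≤ z.im) :
    ∃ C : Set ℂ, IsCompact C ∧ IsPreconnected C ∧ C ⊆ GOOD ∧
      (∀ z ∈ C, ∃ j ≤ N, dist z (P j) ≤ 10 * s) ∧ Vc 0 ⊆ C ∧ Hc N ⊆ C := by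
  have hs : 0 ≤ s := by
    obtain ⟨-, -, -, hR, ⟨z, hz, h1⟩, -⟩ := hH 0 (Nat.zero_le _)
    have := (Complex.mem_reProdIm.1 (hR hz)).1.1
    linarith
  -- the plus at `j`: `Hc j ∪ Vc j` is a continuum
  have hplus : ∀ j ≤ N, IsPreconnected (Hc j ∪ Vc j) := fun j hj => by
    obtain ⟨hHc, hHp, -, hHR, hHa, hHb⟩ := hH j hj
    obtain ⟨hVc', hVp, -, hVR, hVa, hVb⟩ := hV j hj
    obtain ⟨z, hzV, hzH⟩ := plus_meet (by rw [dist_self]; exact hs) hHc hHp hHR hHa hHb hVc' hVp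
      hVR hVa hVb
    exact IsPreconnected.union z hzH hzV hHp hVp
  -- induction on the length of the chain
  suffices key : ∀ k ≤ N, ∃ C : Set ℂ, IsCompact C ∧ IsPreconnected C ∧ C ⊆ GOOD ∧
      (∀ z ∈ C, ∃ j ≤ k, dist z (P j) ≤ 10 * s) ∧ Vc 0 ⊆ C ∧ Hc k ⊆ C by
    obtain ⟨C, h1, h2, h3, h4, h5, h6⟩ := key N le_rfl
    exact ⟨C, h1, h2, h3, fun z hz => h4 z hz, h5, h6⟩
  intro k
  induction k with
  | zero =>
    intro _
    obtain ⟨hHc, hHp, hHG, hHR, hHa, hHb⟩ := hH 0 (Nat.zero_le _)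
    obtain ⟨hVc', hVp, hVG, hVR, hVa, hVb⟩ := hV 0 (Nat.zero_le _)
    refine ⟨Hc 0 ∪ Vc 0, hHc.union hVc', hplus 0 (Nat.zero_le _), union_subset hHG hVG,
      fun z hz => ⟨0, le_rfl, ?_⟩, subset_union_right, subset_union_left⟩
    rcases hz with hz | hz
    · exact dist_le_of_mem_boxes (Or.inl (hHR hz))
    · exact dist_le_of_mem_boxes (Or.inr (hVR hz))
  | succ k ih =>
    intro hk
    obtain ⟨C, hCc, hCp, hCG, hCd, hC0, hCk⟩ := ih (Nat.le_of_succ_le hk)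
    obtain ⟨hHc, hHp, hHG, hHR, hHa, hHb⟩ := hH (k + 1) hk
    obtain ⟨hVc', hVp, hVG, hVR, hVa, hVb⟩ := hV (k + 1) hk
    obtain ⟨hHc₀, hHp₀, -, hHR₀, hHa₀, hHb₀⟩ := hH k (Nat.le_of_succ_le hk)
    -- the horizontal continuum at `k` meets the vertical one at `k + 1`
    obtain ⟨z, hzV, hzH⟩ := plus_meet (hP k hk) hHc₀ hHp₀ hHR₀ hHa₀ hHb₀ hVc' hVp hVR hVa hVb
    refine ⟨C ∪ (Hc (k + 1) ∪ Vc (k + 1)), hCc.union (hHc.union hVc'),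
      IsPreconnected.union z (hCk hzH) (Or.inr hzV) hCp (hplus (k + 1) hk),
      union_subset hCG (union_subset hHG hVG), fun w hw => ?_,
      hC0.trans subset_union_left, subset_union_left.trans subset_union_right⟩
    rcases hw with hw | hw | hw
    · obtain ⟨j, hj, hjd⟩ := hCd w hw
      exact ⟨j, hj.trans (Nat.le_succ k), hjd⟩
    · exact ⟨k + 1, le_rfl, dist_le_of_mem_boxes (Or.inl (hHR hw))⟩
    · exact ⟨k + 1, le_rfl, dist_le_of_mem_boxes (Or.inr (hVR hw))⟩

/-! ## The tube of a quad -/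

/-- **The tube lemma.**  For every quad `Q` there are finitely many points `P₀, …, P_N` at
consecutive distances `≤ s` (`s > 0`; all independent of any mesh) such that every compact
connected plane set inside `GOOD`, within `10 s` of the points and reaching the
`10 s`-neighbourhoods of `P₀` and `P_N`, contains a crossing of `Q` inside `GOOD`. -/
theorem stub_jointCrossing_tube : ∀ Q : Quad (Set.univ : Set ℂ),
    ∃ (N : ℕ) (P : ℕ → ℂ) (s : ℝ), 0 < s ∧ (∀ j < N, dist (P j) (P (j + 1)) ≤ s) ∧
      ∀ (GOOD C : Set ℂ), IsCompact C → IsPreconnected C → C ⊆ GOOD →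
        (∀ z ∈ C, ∃ j ≤ N, dist z (P j) ≤ 10 * s) → (∃ z ∈ C, dist z (P 0) ≤ 10 * s) →
        (∃ z ∈ C, dist z (P N) ≤ 10 * s) → ∃ K, Q.IsCrossing K ∧ K ⊆ GOOD := by
  intro Q
  obtain ⟨H, -, hcar, h0, -, h2, -⟩ := Q.exists_straighten
  -- the room of the chart along the arc `H([-2, 2])`
  obtain ⟨ρ, hρ, hroom⟩ := exists_chart_room H
    (isCompact_Icc.image Complex.continuous_ofReal : IsCompact (((↑) : ℝ → ℂ) '' Icc (-2 : ℝ) 2))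
    (by norm_num : (0 : ℝ) < 1 / 2)
  -- uniform continuity of the arc
  set g : ℝ → ℂ := fun x => H (x : ℂ) with hg
  have hgc : Continuous g := H.continuous.comp Complex.continuous_ofReal
  obtain ⟨τ, hτ, hτg⟩ := Metric.uniformContinuousOn_iff_le.1
    (isCompact_Icc.uniformContinuousOn_of_continuous hgc.continuousOn) (ρ / 20) (by positivity)
  obtain ⟨N, hN⟩ := exists_nat_gt (4 / τ)
  have hNpos : (0 : ℝ) < N := lt_trans (by positivity) hN
  have hstep : 4 / (N : ℝ) ≤ τ := by
    rw [div_le_iff₀ hNpos]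
    have := (div_lt_iff₀ hτ).1 hN
    linarith
  set x : ℕ → ℝ := fun j => -2 + 4 * j / N with hx
  have hxmem : ∀ j ≤ N, x j ∈ Icc (-2 : ℝ) 2 := fun j hj => by
    have hj' : (j : ℝ) ≤ N := by exact_mod_cast hj
    have e1 : (0 : ℝ) ≤ 4 * j / N := by positivity
    have e2 : (j : ℝ) / N ≤ 1 := (div_le_one hNpos).2 hj'
    simp only [hx, mem_Icc]
    rw [show (4 : ℝ) * j / N = 4 * (j / N) by ring] at e1 ⊢
    constructor <;> linarith
  refine ⟨N, fun j => g (x j), ρ / 20, by positivity, fun j hj => ?_, ?_⟩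
  · refine hτg (x j) (hxmem j hj.le) (x (j + 1)) (hxmem (j + 1) hj) ?_
    rw [Real.dist_eq]
    simp only [hx, Nat.cast_add, Nat.cast_one]
    rw [show -2 + 4 * (j : ℝ) / N - (-2 + 4 * ((j : ℝ) + 1) / N) = -(4 / N) by ring, abs_neg,
      abs_of_pos (by positivity)]
    exact hstep
  intro GOOD C hC hCc hCG hnear hP0 hPN
  -- chart positions of the points of `C`
  have hpull : ∀ z : ℂ, ∀ j ≤ N, dist z (g (x j)) ≤ 10 * (ρ / 20) →
      |(H.symm z).re - x j| ≤ 1 / 2 ∧ |(H.symm z).im| ≤ 1 / 2 := fun z j hj hd => by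
    have h := hroom (x j : ℂ) ⟨x j, hxmem j hj, rfl⟩ z (by linarith)
    rw [dist_eq_norm] at h
    refine ⟨?_, ?_⟩
    · have := Complex.abs_re_le_norm (H.symm z - (x j : ℂ))
      rw [Complex.sub_re, Complex.ofReal_re] at this
      exact this.trans h
    · have := Complex.abs_im_le_norm (H.symm z - (x j : ℂ))
      rw [Complex.sub_im, Complex.ofReal_im, sub_zero] at this
      exact this.trans h
  set C' : Set ℂ := H.symm '' C with hC'
  have hband : ∀ w ∈ C', |w.im| ≤ 1 / 2 := by
    rintro _ ⟨z, hz, rfl⟩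
    obtain ⟨j, hj, hd⟩ := hnear z hz
    exact (hpull z j hj hd).2
  obtain ⟨z0, hz0, hz0d⟩ := hP0
  obtain ⟨zN, hzN, hzNd⟩ := hPN
  have hx0 : x 0 = -2 := by simp [hx]
  have hxN : x N = 2 := by
    simp only [hx]
    rw [mul_div_assoc, div_self hNpos.ne']
    norm_num
  have hre0 : (H.symm z0).re ≤ -1 := by
    have := (hpull z0 0 (Nat.zero_le _) hz0d).1
    rw [hx0, abs_le] at this
    linarith [this.2]
  have hreN : 1 ≤ (H.symm zN).re := by
    have := (hpull zN N le_rfl hzNd).1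
    rw [hxN, abs_le] at this
    linarith [this.1]
  obtain ⟨K', hK'C, hK'c, hK'p, hK'strip, ⟨u, hu, hure⟩, ⟨v, hv, hvre⟩⟩ :=
    exists_subcontinuum_between_lines (a := -1) (b := 1) (by norm_num) (hC.image H.symm.continuous)
      (hCc.image _ H.symm.continuous.continuousOn) ⟨_, ⟨z0, hz0, rfl⟩, hre0⟩
      ⟨_, ⟨zN, hzN, rfl⟩, hreN⟩
  have hK'sq : K' ⊆ Icc (-1 : ℝ) 1 ×ℂ Icc (-1 : ℝ) 1 := fun w hw => by
    have h1 := hK'strip w hw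
    have h2 := abs_le.1 (hband w (hK'C hw))
    exact Complex.mem_reProdIm.2 ⟨⟨h1.1, h1.2⟩, ⟨by linarith [h2.1], by linarith [h2.2]⟩⟩
  refine ⟨H '' K', ⟨hK'c.image H.continuous,
    ⟨⟨H u, mem_image_of_mem _ hu⟩, hK'p.image _ H.continuous.continuousOn⟩, ?_, ?_, ?_⟩, ?_⟩
  · rw [hcar]; exact image_mono hK'sq
  · rw [h0]; exact ⟨H u, mem_image_of_mem _ hu, mem_image_of_mem _ ⟨hK'sq hu, hure⟩⟩
  · rw [h2]; exact ⟨H v, mem_image_of_mem _ hv, mem_image_of_mem _ ⟨hK'sq hv, hvre⟩⟩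
  · rintro _ ⟨w, hw, rfl⟩
    obtain ⟨z, hz, rfl⟩ := hK'C hw
    rw [Homeomorph.apply_symm_apply]
    exact hCG hz

end Summit.CriticalPhenomena.CardyFormulaZ2.Theorems.CardySelfRefinement

end
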